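import Literature.Barriers.CriticalPhenomena.LaceExpansionGaussianDeconvolutionTrigSums
import Literature.Barriers.CriticalPhenomena.LaceExpansionGaussianDeconvolution
import Literature.Barriers.CriticalPhenomena.LaceExpansionIsingDeconvolutionProp12FourierRep
import Literature.Barriers.CriticalPhenomena.LaceExpansionIsingDeconvolutionProp12Lem51
import Literature.Barriers.CriticalPhenomena.LaceExpansionSymbolCalculus
import Literature.Barriers.CriticalPhenomena.LaceExpansionIsingGreenComparisonSymbols
import Literature.Barriers.CriticalPhenomena.LaceExpansionKernelTaylor
import Mathlib.Analysis.Calculus.IteratedDeriv.Lemmas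
import Mathlib.Algebra.Order.ToIntervalMod
import HarnessLib

/-!
# One-directional slice calculus for finite trigonometric sums, and the regularised symbols
# `F̂ + m²`, `Â + λm²`, `Ê`, `f̂_m = Ê/((Â + λm²)(F̂ + m²))` of Liu–Slade's proof of Theorem 1.2

Support file (all results proved) for the proof of the named fact
`SpreadOutIsing.LiuSlade2024_thm12_critical` (Liu–Slade 2024, Theorem 1.2, critical case). The
source isolates the leading term of `G = 𝓕⁻¹(1/F̂)` as `G = λC_μ + f`, `f̂ = Ĉ Ê Ĝ = Ê/(ÂF̂)`,
`E = A_μ - λF` (§2.1, (2.2)–(2.4)) and estimates derivatives of `f̂`. Only PURE derivatives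
`∂^n/∂k_j^n` in one coordinate direction are ever needed (proof of Lemma 2.9), so all calculus is
done here along the coordinate slices `s ↦ ψ(k with k_j := s)` with Mathlib's `iteratedDeriv`:

* `LS24.dj j n ψ k` — the `n`-th derivative of `ψ : ℝ^d → ℝ` in the direction `e_j` at `k`;
  Leibniz (`dj_mul`, from `iteratedDeriv_mul`) and the reciprocal recursion
  `φ · ∂^r(1/φ) = -Σ_{i<r} C(r,i+1) ∂^{i+1}φ · ∂^{r-1-i}(1/φ)` (`mul_dj_inv_eq`, from the tree's
  `mul_iteratedDeriv_inv_eq`), the difference operator `LS24.symDiff j u ψ (k) = ψ(k + ue_j) - ψ(k - ue_j)`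
  (`U_u` of §2.3.1) and its commutation with `dj`;
* slices of the phased cosine sums of `…TrigSums.lean`:
  `∂_j^n Σ_x c(x) cos(k·x + θ) = Σ_x c(x) x_j^n cos(k·x + θ + nπ/2)` (`dj_trigSum`),
  `U_u Σ_x c(x) cos(k·x + θ) = Σ_x (-2 sin(u x_j) c(x)) cos(k·x + θ + π/2)` (`symDiff_trigSum`);
* the DATA of the theorem after truncation and mass regularisation (`LS24.Data d K₁ K₂ ρ`): a
  finitely supported `ℤ^d`-symmetric `F` with `|F(x)| ≤ K₁⟦x⟧^{-(d+2+ρ)}`, `Σ_x F(x) = 0` (critical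
  case), the infrared bound `F̂(k) ≥ K₂‖k‖_∞²` for `‖k‖_∞ ≤ π + 1` (the form in which the
  hypothesis `F̂(k) - F̂(0) ≥ K₂|k|²` of Assumption 1.1 is consumed, shifts by `|u| ≤ 1` included),
  and a mass `0 < m ≤ 1`; over it the symbols `F̂ = Σ_x F(x)cos(k·x)` (`Fhat`),
  `Â = 1 - D̂_nn` (`Ahat`, through the tree's `nnSymbol`), `F'' = -Σ|x|²F(x)`, `λ = 1/F''`
  ((1.10), (1.12)), `Ê = Â - λF̂`, the regularised denominators `F̂ + m²`, `Â + λm²` and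
  `f̂_m = 1/(F̂ + m²) - λ/(Â + λm²) = Ê/((Â + λm²)(F̂ + m²))` (`fhat`), with their smoothness along
  slices, periodicity, and the elementary bounds `|F̂| ≤ C`, `|∂_jF̂(k)| ≤ C‖k‖`, `|∂_j²F̂| ≤ C`,
  `F'' ≥ 2dK₂` (the source's (1.10): the infrared bound at `k = εe_j` gives `Σ_x x_j²F(x) ≤ -2K₂`
  for each of the `d` axes; `Data.le_Fpp`), `0 < λ ≤ 1/(2dK₂)`.

Bridges (review of 2026-08-15): `Data.Fpp_eq_ls24Fpp`, `Data.lam_eq_ls24Lambda`, `Data.ls24Mu_eq_one`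
and `Data.Efun_eq_lsA_sub` pin the finite-sum constants `F''`, `λ` and the function `E` of the data to
the tree's `ls24Fpp`, `ls24Lambda`, `ls24Mu` ((1.10), (1.12), `LaceExpansionGaussianDeconvolution.lean`)
and to `E = A_μ - λF` (`ls24E`).

## References

* Y. Liu, G. Slade, *Gaussian deconvolution and the lace expansion*, Probab. Theory Related
  Fields (2024), arXiv:2310.07635: §1.2 ((1.8)–(1.12), Assumption 1.1), §2.1 ((2.2)–(2.4)),
  §2.3.1 (definition of `U_u`), proof of Lemma 2.9 (only `α = (j,…,j)` is used) [LiuSlade2024].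
-/

noncomputable section

namespace Literature.Barriers.CriticalPhenomena.SpreadOutIsing

namespace LS24

open _root_.MeasureTheory _root_.Filter Real Finset Literature.Probability.LatticeModels
open Literature.Probability.Percolation (kdot_add kdot_neg)
open scoped ENNReal NNReal BigOperators _root_.Topology

variable {d : ℕ}

/-! ## Part 1. Slice calculus -/

/-- The `n`-th derivative of `ψ : ℝ^d → ℝ` in the coordinate direction `e_j` at the point `k`:
`iteratedDeriv n (s ↦ ψ(k with k_j := s)) (k_j)`. [cite: LiuSlade2024, §2.1 (the operator ∇^α; here α = n e_j)] -/
def dj (j : Fin d) (n : ℕ) (ψ : (Fin d → ℝ) → ℝ) (k : Fin d → ℝ) : ℝ :=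
  iteratedDeriv n (fun s => ψ (Function.update k j s)) (k j)

/-- The slice of `dj j n ψ` through `k` is the `n`-th derivative of the slice of `ψ`. [folklore] -/
theorem dj_update (j : Fin d) (n : ℕ) (ψ : (Fin d → ℝ) → ℝ) (k : Fin d → ℝ) (s : ℝ) :
    dj j n ψ (Function.update k j s) = iteratedDeriv n (fun s' => ψ (Function.update k j s')) s := by
  unfold dj
  simp only [Function.update_idem, Function.update_self]

/-- `∂_j^0 ψ = ψ`. [folklore] -/
@[simp] theorem dj_zero (j : Fin d) (ψ : (Fin d → ℝ) → ℝ) : dj j 0 ψ = ψ := by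
  funext k
  simp [dj]

/-- `∂_j^{n+1} ψ = ∂_j (∂_j^n ψ)` along slices: the slice of `dj j n ψ` has derivative
`dj j (n+1) ψ` wherever the slice of `ψ` is `C^{n+1}`. [folklore] -/
theorem hasDerivAt_dj_slice {j : Fin d} {n : ℕ} {ψ : (Fin d → ℝ) → ℝ} {k : Fin d → ℝ}
    (hψ : ContDiff ℝ (n + 1 : ℕ) fun s => ψ (Function.update k j s)) (s : ℝ) :
    HasDerivAt (fun s' => dj j n ψ (Function.update k j s')) (dj j (n + 1) ψ (Function.update k j s)) s := by
  have h : (fun s' => dj j n ψ (Function.update k j s')) =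
      iteratedDeriv n (fun s' => ψ (Function.update k j s')) := by
    funext s'; exact dj_update j n ψ k s'
  rw [h, dj_update, iteratedDeriv_succ]
  refine DifferentiableAt.hasDerivAt ?_
  exact (hψ.differentiable_iteratedDeriv n (by exact_mod_cast Nat.lt_succ_self n)).differentiableAt

/-- **Leibniz along a slice**: `∂_j^n(ψ₁ψ₂) = Σ_i C(n,i) ∂_j^i ψ₁ · ∂_j^{n-i} ψ₂` at every point
whose slices are `C^n`. [folklore] -/
theorem dj_mul {j : Fin d} {n : ℕ} {ψ₁ ψ₂ : (Fin d → ℝ) → ℝ} {k : Fin d → ℝ}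
    (h₁ : ContDiff ℝ n fun s => ψ₁ (Function.update k j s))
    (h₂ : ContDiff ℝ n fun s => ψ₂ (Function.update k j s)) :
    dj j n (fun k' => ψ₁ k' * ψ₂ k') k =
      ∑ i ∈ range (n + 1), (n.choose i : ℝ) * dj j i ψ₁ k * dj j (n - i) ψ₂ k := by
  unfold dj
  have := iteratedDeriv_mul (x := k j) h₁.contDiffAt h₂.contDiffAt
  exact this

/-- **The reciprocal recursion along a slice**: if the slice of `φ` through `k` is `C^n` and
vanishes nowhere, then for `1 ≤ r ≤ n`,
`φ(k) ∂_j^r(1/φ)(k) = -Σ_{i<r} C(r,i+1) ∂_j^{i+1}φ(k) ∂_j^{r-1-i}(1/φ)(k)` (the tree's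
`mul_iteratedDeriv_inv_eq`). [cite: LiuSlade2024, Appendix A, Lemma A.3 (quotient rule; here in classical form along a slice)] -/
theorem mul_dj_inv_eq {j : Fin d} {n r : ℕ} {φ : (Fin d → ℝ) → ℝ} {k : Fin d → ℝ}
    (hφ : ContDiff ℝ n fun s => φ (Function.update k j s))
    (hne : ∀ s, φ (Function.update k j s) ≠ 0) (hr1 : 1 ≤ r) (hrn : r ≤ n) :
    φ k * dj j r (fun k' => (φ k')⁻¹) k =
      -∑ i ∈ range r, (r.choose (i + 1) : ℝ) * dj j (i + 1) φ k * dj j (r - (i + 1)) (fun k' => (φ k')⁻¹) k := by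
  have h := mul_iteratedDeriv_inv_eq (s := k j) hφ hne hr1 hrn
  simp only [Function.update_eq_self] at h
  exact h

/-- The symmetric difference operator `U_u` of §2.3.1 in the direction `e_j`:
`(U_u ψ)(k) = ψ(k + u e_j) - ψ(k - u e_j)`. [cite: LiuSlade2024, §2.3.1 (definition of U_u)] -/
def symDiff (j : Fin d) (u : ℝ) (ψ : (Fin d → ℝ) → ℝ) (k : Fin d → ℝ) : ℝ :=
  ψ (k + Pi.single j u) - ψ (k - Pi.single j u)

/-- `update k j s ± u e_j = update k j (s ± u)`. [folklore] -/
theorem update_add_single (k : Fin d → ℝ) (j : Fin d) (s u : ℝ) :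
    Function.update k j s + Pi.single j u = Function.update k j (s + u) := by
  ext i
  by_cases hi : i = j
  · subst hi; simp
  · simp [Function.update_of_ne hi, Pi.single_eq_of_ne hi]

/-- `update k j s - u e_j = update k j (s - u)`. [folklore] -/
theorem update_sub_single (k : Fin d → ℝ) (j : Fin d) (s u : ℝ) :
    Function.update k j s - Pi.single j u = Function.update k j (s - u) := by
  rw [sub_eq_add_neg, ← Pi.single_neg, update_add_single, sub_eq_add_neg]

/-- `k ± u e_j = update k j (k_j ± u)`. [folklore] -/
theorem add_single_eq_update (k : Fin d → ℝ) (j : Fin d) (u : ℝ) :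
    k + Pi.single j u = Function.update k j (k j + u) := by
  conv_lhs => rw [← Function.update_eq_self j k]
  exact update_add_single k j (k j) u

/-- `k - u e_j = update k j (k_j - u)`. [folklore] -/
theorem sub_single_eq_update (k : Fin d → ℝ) (j : Fin d) (u : ℝ) :
    k - Pi.single j u = Function.update k j (k j - u) := by
  conv_lhs => rw [← Function.update_eq_self j k]
  exact update_sub_single k j (k j) u

/-- **`U_u` commutes with `∂_j^n`** (both act along the same slice; translation invariance of the
derivative): `∂_j^n (U_u ψ)(k) = U_u (∂_j^n ψ)(k)` when the slice of `ψ` through `k` is `C^n`.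
[cite: LiuSlade2024, §2.3.2 (U_u f̂_α)] -/
theorem dj_symDiff {j : Fin d} {n : ℕ} {u : ℝ} {ψ : (Fin d → ℝ) → ℝ} {k : Fin d → ℝ}
    (hψ : ContDiff ℝ n fun s => ψ (Function.update k j s)) :
    dj j n (symDiff j u ψ) k = symDiff j u (dj j n ψ) k := by
  set g : ℝ → ℝ := fun s => ψ (Function.update k j s) with hg
  have hL : (fun s => symDiff j u ψ (Function.update k j s)) =
      fun s => g (s + u) - g (s - u) := by
    funext s
    simp only [symDiff, update_add_single, update_sub_single, hg]
  unfold dj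
  rw [hL]
  have h1 : ContDiff ℝ n fun s => g (s + u) := hψ.comp (contDiff_id.add contDiff_const)
  have h2 : ContDiff ℝ n fun s => g (s - u) := hψ.comp (contDiff_id.sub contDiff_const)
  rw [show (fun s => g (s + u) - g (s - u)) = (fun s => g (s + u)) - fun s => g (s - u) from rfl,
    iteratedDeriv_sub h1.contDiffAt h2.contDiffAt, iteratedDeriv_comp_add_const,
    iteratedDeriv_comp_sub_const]
  simp only [symDiff, add_single_eq_update, sub_single_eq_update, hg, Function.update_idem,
    Function.update_self]

/-! ## Part 2. Slices of phased cosine sums -/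

/-- The slice of a phased cosine sum through `k` in the direction `e_j` is a finite sum of
`cos(a_x s + b_x)`: `T(k[j↦s]) = Σ_x c(x) cos(x_j s + (k·x - k_j x_j + θ))`. [folklore] -/
theorem trigSum_update (S : Finset (Site d)) (c : Site d → ℝ) (θ : ℝ) (k : Fin d → ℝ) (j : Fin d)
    (s : ℝ) : trigSum S c θ (Function.update k j s) =
      ∑ x ∈ S, c x * Real.cos (((x j : ℤ) : ℝ) * s + (kdot k x - k j * ((x j : ℤ) : ℝ) + θ)) := by
  unfold trigSum
  refine sum_congr rfl fun x _ => ?_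
  rw [kdot_update_eq_affine, add_assoc]

/-- The slice of a phased cosine sum is smooth. [folklore] -/
theorem contDiff_trigSum_slice (S : Finset (Site d)) (c : Site d → ℝ) (θ : ℝ) (k : Fin d → ℝ)
    (j : Fin d) {n : WithTop ℕ∞} : ContDiff ℝ n fun s => trigSum S c θ (Function.update k j s) := by
  simp_rw [trigSum_update]
  exact ContDiff.sum fun x _ => contDiff_const.mul (contDiff_cos_affine _ _)

/-- **Derivatives of a phased cosine sum along a slice**:
`(d/ds)^n T(k[j↦s]) = Σ_x c(x) x_j^n cos((k[j↦s])·x + θ + nπ/2)`, i.e. again a phased cosine sum,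
with coefficients `c(x) x_j^n` and phase `θ + nπ/2`. [cite: LiuSlade2024, Appendix A, Lemma A.4 (∇^α f̂ = 𝓕[(ix)^α f]; classical form for finite sums)] -/
theorem iteratedDeriv_trigSum_slice (n : ℕ) (S : Finset (Site d)) (c : Site d → ℝ) (θ : ℝ)
    (k : Fin d → ℝ) (j : Fin d) (s : ℝ) :
    iteratedDeriv n (fun s' => trigSum S c θ (Function.update k j s')) s =
      trigSum S (fun x => c x * ((x j : ℤ) : ℝ) ^ n) (θ + n * (π / 2)) (Function.update k j s) := by
  simp_rw [trigSum_update]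
  rw [iteratedDeriv_fun_sum fun x _ => (contDiff_const.mul (contDiff_cos_affine _ _)).contDiffAt]
  refine sum_congr rfl fun x _ => ?_
  rw [show (fun s' => c x * Real.cos (((x j : ℤ) : ℝ) * s' + (kdot k x - k j * ((x j : ℤ) : ℝ) + θ))) =
      fun s' => c x * (fun s'' => Real.cos (((x j : ℤ) : ℝ) * s'' + (kdot k x - k j * ((x j : ℤ) : ℝ) + θ))) s'
      from rfl, iteratedDeriv_const_mul _ (contDiff_cos_affine _ _).contDiffAt,
    iteratedDeriv_cos_affine]
  ring_nf

/-- **`∂_j^n Σ_x c(x) cos(k·x + θ) = Σ_x c(x) x_j^n cos(k·x + θ + nπ/2)`.**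
[cite: LiuSlade2024, Appendix A, Lemma A.4 (∇^α f̂ = 𝓕[(ix)^α f]; classical form for finite sums)] -/
theorem dj_trigSum (j : Fin d) (n : ℕ) (S : Finset (Site d)) (c : Site d → ℝ) (θ : ℝ) :
    dj j n (trigSum S c θ) = trigSum S (fun x => c x * ((x j : ℤ) : ℝ) ^ n) (θ + n * (π / 2)) := by
  funext k
  rw [dj, iteratedDeriv_trigSum_slice, Function.update_eq_self]

/-- **`U_u` of a phased cosine sum**: `U_u Σ_x c(x) cos(k·x + θ) = Σ_x 2 sin(u x_j) c(x) cos(k·x + θ + π/2)`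
(`cos(t + a) - cos(t - a) = -2 sin t sin a`), i.e. again a phased cosine sum, with coefficients
`2 sin(u x_j) c(x)`. This is "`U_u ĥ` is the Fourier transform of `2i sin(ux₁) h(x)`" of the
source. [cite: LiuSlade2024, proof of Lemma 2.14 (i)] -/
theorem symDiff_trigSum (j : Fin d) (u : ℝ) (S : Finset (Site d)) (c : Site d → ℝ) (θ : ℝ)
    (k : Fin d → ℝ) : symDiff j u (trigSum S c θ) k =
      trigSum S (fun x => 2 * Real.sin (u * ((x j : ℤ) : ℝ)) * c x) (θ + π / 2) k := by
  have hadd : ∀ (k l : Fin d → ℝ) (x : Site d), kdot (k + l) x = kdot k x + kdot l x := fun k l x => by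
    simp only [kdot, Pi.add_apply, add_mul, sum_add_distrib]
  unfold symDiff trigSum
  rw [← sum_sub_distrib]
  refine sum_congr rfl fun x _ => ?_
  rw [sub_eq_add_neg k, ← Pi.single_neg, hadd, hadd, kdot_single, kdot_single,
    ← mul_sub, ← add_assoc, Real.cos_add_pi_div_two, add_right_comm _ _ θ,
    show kdot k x + (-u) * ((x j : ℤ) : ℝ) + θ = (kdot k x + θ) - u * ((x j : ℤ) : ℝ) by ring,
    Real.cos_add, Real.cos_sub]
  ring

/-! ## Part 3. The data of the regularised problem and its symbols -/

/-- **The data after truncation and mass regularisation.** A function `F : ℤ^d → ℝ` supported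
in the finite set `S`, `ℤ^d`-symmetric, with `|F(x)| ≤ K₁⟦x⟧^{-(d+2+ρ)}` and `Σ_x F(x) = 0` (the
critical case `F̂(0) = 0` of Assumption 1.1), whose transform `F̂(k) = Σ_x F(x)cos(k·x)` obeys the
infrared bound `F̂(k) ≥ K₂‖k‖_∞²` on the enlarged cube `‖k‖_∞ ≤ π + 1` (this is the hypothesis
`F̂(k) - F̂(0) ≥ K₂|k|²` (`k ∈ 𝕋^d`) of Assumption 1.1 in the form in which the proof consumes it,
shifted arguments `k ± u e_j`, `0 ≤ u ≤ 1`, included), together with a mass `0 < m ≤ 1`. All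
estimates of the sequel are UNIFORM in `Data d K₁ K₂ ρ`. [cite: LiuSlade2024, Assumption 1.1 with (1.9)] -/
structure Data (d : ℕ) (K₁ K₂ ρ : ℝ) where
  /-- the lattice function -/
  F : Site d → ℝ
  /-- a finite set carrying its support -/
  S : Finset (Site d)
  /-- the mass -/
  m : ℝ
  support : ∀ x, x ∉ S → F x = 0
  symm : IsZdSymmetric F
  decay : ∀ x, |F x| ≤ K₁ * jnorm x ^ (-((d : ℝ) + 2 + ρ))
  sum_eq_zero : ∑ x ∈ S, F x = 0
  infrared : ∀ k : Fin d → ℝ, ‖k‖ ≤ π + 1 → K₂ * ‖k‖ ^ 2 ≤ trigSum S F 0 k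
  m_pos : 0 < m
  m_le_one : m ≤ 1

/-- The support of `A_1 = δ - D_nn`: the origin and its `2d` neighbours. [cite: LiuSlade2024, §2.1 (A_μ = δ - μD)] -/
def nnSet (d : ℕ) : Finset (Site d) := insert 0 ((zdGraph d).neighborFinset 0)

/-- `Â(k) = Σ_x A_1(x) cos(k·x) = 1 - D̂_nn(k)` as a phased cosine sum. [cite: LiuSlade2024, §2.1 (Â = 1 - μD̂), (1.11)] -/
def Ahat (d : ℕ) : (Fin d → ℝ) → ℝ := trigSum (nnSet d) (lsA d 1) 0

/-- The lattice sum `Σ_{x ∈ ℤ^d} ⟦x⟧^{-a}` (finite for `a > d`), the shape of all constants below.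
[folklore] -/
def jsum (d : ℕ) (a : ℝ) : ℝ := ∑' x : Site d, jnorm x ^ (-a)

/-- `Σ_x ⟦x⟧^{-a} ≥ 0`. [folklore] -/
theorem jsum_nonneg (d : ℕ) (a : ℝ) : 0 ≤ jsum d a :=
  tsum_nonneg fun x => Real.rpow_nonneg (jnorm_pos x).le _

namespace Data

variable {K₁ K₂ ρ : ℝ} (D : Data d K₁ K₂ ρ)

/-- `F̂(k) = Σ_x F(x) cos(k·x)`. [cite: LiuSlade2024, (1.4)] -/
def Fhat : (Fin d → ℝ) → ℝ := trigSum D.S D.F 0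

/-- `F'' = -Σ_x |x|² F(x)`. [cite: LiuSlade2024, (1.10)] -/
def Fpp : ℝ := -∑ x ∈ D.S, euclidNorm x ^ 2 * D.F x

/-- `λ = 1/F''` (the critical case of (1.12)). [cite: LiuSlade2024, (1.12)] -/
def lam : ℝ := (D.Fpp)⁻¹

/-- `E = A_1 - λF` on `ℤ^d`. [cite: LiuSlade2024, §2.1 (E_{λ,μ} = A_μ - λF)] -/
def Efun (x : Site d) : ℝ := lsA d 1 x - D.lam * D.F x

/-- A finite set carrying the support of `E`. [cite: LiuSlade2024, §2.1] -/
def ES : Finset (Site d) := nnSet d ∪ D.S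

/-- `Ê(k) = Σ_x E(x) cos(k·x)`. [cite: LiuSlade2024, §2.1 and Lemma 2.2] -/
def Ehat : (Fin d → ℝ) → ℝ := trigSum D.ES D.Efun 0

/-- The regularised denominator `F̂ + m²`. [cite: LiuSlade2024, §2.1 (here with a mass m > 0)] -/
def phi (k : Fin d → ℝ) : ℝ := D.Fhat k + D.m ^ 2

/-- The regularised denominator `Â + λm²` (so that `(Â + λm²) - λ(F̂ + m²) = Ê`).
[cite: LiuSlade2024, §2.1 (here with a mass m > 0)] -/
def areg (k : Fin d → ℝ) : ℝ := Ahat d k + D.lam * D.m ^ 2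

/-- The regularised error symbol `f̂_m = Ê/((Â + λm²)(F̂ + m²)) = 1/(F̂ + m²) - λ/(Â + λm²)`.
[cite: LiuSlade2024, §2.1 (f̂ = Ĉ Ê Ĝ) and Proposition 2.4] -/
def fhat (k : Fin d → ℝ) : ℝ := D.Ehat k / (D.areg k * D.phi k)

end Data

/-! ### `Â` explicitly, and its infrared bound on the enlarged cube -/

/-- `Â(k) = ε(k)/d` with `ε(k) = Σ_i (1 - cos k_i)` (`d ≥ 1`). [cite: LiuSlade2024, (1.11)] -/
theorem Ahat_eq (hd : 1 ≤ d) (k : Fin d → ℝ) : Ahat d k = dispersion k / d := by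
  have h0 : (0 : Site d) ∉ (zdGraph d).neighborFinset 0 := by
    rw [SimpleGraph.mem_neighborFinset]; exact SimpleGraph.irrefl _
  unfold Ahat trigSum nnSet
  rw [sum_insert h0]
  simp only [add_zero, lsA_one, delta0_zero, kdot_zero_right, Real.cos_zero, mul_one]
  have hsrw0 : srwStep d 0 = 0 := if_neg (SimpleGraph.irrefl _)
  rw [hsrw0, sub_zero]
  have h1 : ∑ x ∈ (zdGraph d).neighborFinset 0, (delta0 x - srwStep d x) * Real.cos (kdot k x) =
      -∑ x ∈ (zdGraph d).neighborFinset 0, srwStep d x * Real.cos (kdot k x) := by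
    rw [← sum_neg_distrib]
    refine sum_congr rfl fun x hx => ?_
    have hx0 : x ≠ 0 := fun h => h0 (h ▸ hx)
    rw [delta0_of_ne_zero hx0]; ring
  rw [h1]
  have h2 := stepSymbol_srwStep hd k
  unfold stepSymbol at h2
  rw [h2]; ring

/-- Jordan-type bound on the enlarged period interval: `1 - cos t ≥ c t²` for `|t| ≤ π + 1`, with
`c = 2(π-1)²/(π²(π+1)²)` (Jordan's inequality on `[-π,π]`, and `1 - cos t = 1 - cos(2π - |t|)`
beyond). [folklore] -/
theorem mul_sq_le_one_sub_cos {t : ℝ} (ht : |t| ≤ π + 1) :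
    2 * (π - 1) ^ 2 / (π ^ 2 * (π + 1) ^ 2) * t ^ 2 ≤ 1 - Real.cos t := by
  have hπ3 : 3 < π := Real.pi_gt_three
  have hπ4 : π < 4 := Real.pi_lt_four
  have hc1 : 2 * (π - 1) ^ 2 / (π ^ 2 * (π + 1) ^ 2) ≤ 2 / π ^ 2 := by
    rw [div_le_div_iff₀ (by positivity) (by positivity)]
    nlinarith [sq_nonneg (π + 1), sq_nonneg (π - 1)]
  rcases le_or_gt |t| π with h | h
  · have hj := Real.cos_le_one_sub_mul_cos_sq (abs_le.1 h |> fun h => abs_le.2 ⟨h.1, h.2⟩)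
    have : 2 / π ^ 2 * t ^ 2 ≤ 1 - Real.cos t := by linarith
    exact le_trans (mul_le_mul_of_nonneg_right hc1 (sq_nonneg t)) this
  · -- `π < |t| ≤ π + 1`: reduce to `s = 2π - |t| ∈ [π - 1, π)`
    set s : ℝ := 2 * π - |t| with hs
    have hs1 : π - 1 ≤ s := by rw [hs]; linarith
    have hs2 : s < π := by rw [hs]; linarith
    have hs0 : 0 ≤ s := by linarith
    have hcos : Real.cos t = Real.cos s := by
      rw [hs, show 2 * π - |t| = -|t| + 2 * π by ring, Real.cos_add_two_pi, Real.cos_neg,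
        Real.cos_abs]
    have hj := Real.cos_le_one_sub_mul_cos_sq (x := s) (abs_le.2 ⟨by linarith, hs2.le⟩)
    have h1 : 2 / π ^ 2 * (π - 1) ^ 2 ≤ 1 - Real.cos s := by
      have : 2 / π ^ 2 * (π - 1) ^ 2 ≤ 2 / π ^ 2 * s ^ 2 :=
        mul_le_mul_of_nonneg_left (pow_le_pow_left₀ (by linarith) hs1 2) (by positivity)
      linarith
    have ht2 : t ^ 2 ≤ (π + 1) ^ 2 := by
      rw [← sq_abs]; exact pow_le_pow_left₀ (abs_nonneg t) ht 2
    rw [hcos]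
    calc 2 * (π - 1) ^ 2 / (π ^ 2 * (π + 1) ^ 2) * t ^ 2
        ≤ 2 * (π - 1) ^ 2 / (π ^ 2 * (π + 1) ^ 2) * (π + 1) ^ 2 :=
          mul_le_mul_of_nonneg_left ht2 (by positivity)
      _ = 2 / π ^ 2 * (π - 1) ^ 2 := by field_simp
      _ ≤ 1 - Real.cos s := h1

/-- The constant of the infrared bound for `Â` on the enlarged cube. [folklore] -/
def cA (d : ℕ) : ℝ := 2 * (π - 1) ^ 2 / (π ^ 2 * (π + 1) ^ 2) / d

/-- `cA d > 0` for `d ≥ 1`. [folklore] -/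
theorem cA_pos (hd : 1 ≤ d) : 0 < cA d := by
  unfold cA
  have hπ3 : 3 < π := Real.pi_gt_three
  have : (0 : ℝ) < d := by exact_mod_cast hd
  have : 0 < π - 1 := by linarith
  positivity

/-- **Infrared bound for `Â` on the enlarged cube**: `Â(k) ≥ c_A ‖k‖_∞²` for `‖k‖_∞ ≤ π + 1`
(the source's (1.11) on `𝕋^d`, extended past the period cell as the shifted arguments `k ± u e_j`
require). [cite: LiuSlade2024, (1.11)] -/
theorem cA_mul_norm_sq_le_Ahat (hd : 1 ≤ d) {k : Fin d → ℝ} (hk : ‖k‖ ≤ π + 1) :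
    cA d * ‖k‖ ^ 2 ≤ Ahat d k := by
  have hdR : (0 : ℝ) < d := by exact_mod_cast hd
  rw [Ahat_eq hd, cA, div_mul_eq_mul_div, div_le_div_iff_of_pos_right hdR]
  -- the coordinate realising the sup norm
  obtain ⟨i, hi'⟩ : ∃ i : Fin d, ‖k‖ ≤ |k i| := by
    haveI : Nonempty (Fin d) := ⟨⟨0, hd⟩⟩
    obtain ⟨i, _, hi⟩ := Finset.exists_max_image Finset.univ (fun i : Fin d => |k i|)
      Finset.univ_nonempty
    refine ⟨i, (pi_norm_le_iff_of_nonneg (abs_nonneg _)).2 fun l => ?_⟩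
    rw [Real.norm_eq_abs]; exact hi l (Finset.mem_univ l)
  have hki : |k i| ≤ π + 1 := (abs_apply_le_norm k i).trans hk
  calc 2 * (π - 1) ^ 2 / (π ^ 2 * (π + 1) ^ 2) * ‖k‖ ^ 2
      ≤ 2 * (π - 1) ^ 2 / (π ^ 2 * (π + 1) ^ 2) * (k i) ^ 2 := by
        have : ‖k‖ ^ 2 ≤ (k i) ^ 2 := by
          rw [← sq_abs (k i)]; exact pow_le_pow_left₀ (norm_nonneg _) hi' 2
        exact mul_le_mul_of_nonneg_left this (by positivity)
    _ ≤ 1 - Real.cos (k i) := mul_sq_le_one_sub_cos hki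
    _ ≤ dispersion k := by
        unfold dispersion
        exact Finset.single_le_sum (f := fun l => 1 - Real.cos (k l))
          (fun l _ => sub_nonneg.2 (Real.cos_le_one _)) (Finset.mem_univ i)

/-- `0 ≤ Â ≤ 2`. [cite: LiuSlade2024, (1.11)] -/
theorem Ahat_nonneg (hd : 1 ≤ d) (k : Fin d → ℝ) : 0 ≤ Ahat d k := by
  rw [Ahat_eq hd]; exact div_nonneg (dispersion_nonneg k) (Nat.cast_nonneg d)

/-- `Â ≤ 2`. [cite: LiuSlade2024, (1.11)] -/
theorem Ahat_le_two (hd : 1 ≤ d) (k : Fin d → ℝ) : Ahat d k ≤ 2 := by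
  have hdR : (0 : ℝ) < d := by exact_mod_cast hd
  rw [Ahat_eq hd, div_le_iff₀ hdR]
  unfold dispersion
  calc ∑ i, (1 - Real.cos (k i)) ≤ ∑ _i : Fin d, (2 : ℝ) :=
        Finset.sum_le_sum fun i _ => by linarith [Real.neg_one_le_cos (k i)]
    _ = 2 * d := by rw [sum_const, card_univ, Fintype.card_fin, nsmul_eq_mul]; ring

/-! ### Periodic reduction to the cube -/

/-- Every `k ∈ ℝ^d` is `k' + 2πn` with `k' ∈ [-π,π]^d`, `n ∈ ℤ^d`. [folklore] -/
theorem exists_eq_add_twoPi_mul (k : Fin d → ℝ) :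
    ∃ (k' : Fin d → ℝ) (n : Fin d → ℤ), k' ∈ cube d ∧ k = fun j => k' j + 2 * π * n j := by
  refine ⟨fun j => toIocMod Real.two_pi_pos (-π) (k j), fun j => toIocDiv Real.two_pi_pos (-π) (k j),
    fun j _ => ?_, ?_⟩
  · have h := toIocMod_mem_Ioc Real.two_pi_pos (-π) (k j)
    exact ⟨h.1.le, by linarith [h.2]⟩
  · funext j
    have h := (toIocMod_add_toIocDiv_zsmul Real.two_pi_pos (-π) (k j)).symm
    rw [zsmul_eq_mul] at h
    linarith [h]

/-- Points of the cube have sup norm at most `π`. [folklore] -/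
theorem norm_le_pi_of_mem_cube {k : Fin d → ℝ} (hk : k ∈ cube d) : ‖k‖ ≤ π := by
  refine (pi_norm_le_iff_of_nonneg Real.pi_pos.le).2 fun i => ?_
  rw [Real.norm_eq_abs, abs_le]
  exact hk i (Set.mem_univ i)

namespace Data

variable {K₁ K₂ ρ : ℝ} (D : Data d K₁ K₂ ρ)

/-! ### Periodicity, positivity and smoothness of the symbols -/

/-- `F̂` is `2π`-periodic in every coordinate. [folklore] -/
theorem Fhat_periodic (k : Fin d → ℝ) (n : Fin d → ℤ) :
    D.Fhat (fun j => k j + 2 * π * n j) = D.Fhat k := trigSum_add_twoPi_mul _ _ _ k n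

/-- **`F̂ ≥ 0` everywhere** (periodic reduction to the cube and the infrared bound), for
`K₂ ≥ 0`. [cite: LiuSlade2024, Assumption 1.1 (F̂(k) - F̂(0) ≥ K₂|k|², critical case F̂(0) = 0)] -/
theorem Fhat_nonneg (hK₂ : 0 ≤ K₂) (k : Fin d → ℝ) : 0 ≤ D.Fhat k := by
  obtain ⟨k', n, hk', rfl⟩ := exists_eq_add_twoPi_mul k
  rw [D.Fhat_periodic]
  have h := D.infrared k' ((norm_le_pi_of_mem_cube hk').trans (by linarith))
  exact le_trans (by positivity) h

/-- `F̂ + m² ≥ m² > 0`. [folklore] -/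
theorem phi_pos (hK₂ : 0 ≤ K₂) (k : Fin d → ℝ) : 0 < D.phi k := by
  have := D.Fhat_nonneg hK₂ k
  have := D.m_pos
  unfold phi; positivity

/-- **The infrared bound for `F̂ + m²`**: `K₂‖k‖² ≤ F̂(k) + m²` for `‖k‖ ≤ π + 1`.
[cite: LiuSlade2024, Assumption 1.1 (1.9)] -/
theorem mul_norm_sq_le_phi {k : Fin d → ℝ} (hk : ‖k‖ ≤ π + 1) : K₂ * ‖k‖ ^ 2 ≤ D.phi k := by
  have h := D.infrared k hk
  unfold phi Fhat
  nlinarith [sq_nonneg D.m]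

/-- `F̂ + m²` is `2π`-periodic in every coordinate. [folklore] -/
theorem phi_periodic (k : Fin d → ℝ) (n : Fin d → ℤ) :
    D.phi (fun j => k j + 2 * π * n j) = D.phi k := by
  unfold phi; rw [D.Fhat_periodic]

/-- `Ê = Â - λF̂`. [cite: LiuSlade2024, §2.1 (E = A - λF)] -/
theorem Ehat_eq (k : Fin d → ℝ) : D.Ehat k = Ahat d k - D.lam * D.Fhat k := by
  classical
  have hA : Ahat d k = ∑ x ∈ D.ES, lsA d 1 x * Real.cos (kdot k x + 0) := by
    unfold Ahat trigSum
    refine (sum_subset (subset_union_left) fun x _ hx => ?_)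
    have hx0 : x ≠ 0 := fun h => hx (by rw [h, nnSet]; exact mem_insert_self _ _)
    have hxn : x ∉ (zdGraph d).neighborFinset 0 := fun h => hx (by rw [nnSet]; exact mem_insert_of_mem h)
    rw [lsA_one, delta0_of_ne_zero hx0, srwStep_of_not_mem hxn]; ring
  have hF : D.Fhat k = ∑ x ∈ D.ES, D.F x * Real.cos (kdot k x + 0) := by
    unfold Fhat trigSum
    exact sum_subset (subset_union_right) fun x _ hx => by
      rw [D.support x hx]; ring
  rw [hA, hF, mul_sum, ← sum_sub_distrib]
  unfold Ehat trigSum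
  refine sum_congr rfl fun x _ => ?_
  unfold Efun; ring

/-- `Ê` is `2π`-periodic in every coordinate. [folklore] -/
theorem Ehat_periodic (k : Fin d → ℝ) (n : Fin d → ℤ) :
    D.Ehat (fun j => k j + 2 * π * n j) = D.Ehat k := trigSum_add_twoPi_mul _ _ _ k n

/-- `Â` is `2π`-periodic in every coordinate. [folklore] -/
theorem _root_.Literature.Barriers.CriticalPhenomena.SpreadOutIsing.LS24.Ahat_periodic
    (k : Fin d → ℝ) (n : Fin d → ℤ) : Ahat d (fun j => k j + 2 * π * n j) = Ahat d k :=
  trigSum_add_twoPi_mul _ _ _ k n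

/-- `Â + λm²` is `2π`-periodic in every coordinate. [folklore] -/
theorem areg_periodic (k : Fin d → ℝ) (n : Fin d → ℤ) :
    D.areg (fun j => k j + 2 * π * n j) = D.areg k := by
  unfold areg; rw [Ahat_periodic]

/-- `f̂_m` is `2π`-periodic in every coordinate. [folklore] -/
theorem fhat_periodic (k : Fin d → ℝ) (n : Fin d → ℤ) :
    D.fhat (fun j => k j + 2 * π * n j) = D.fhat k := by
  unfold fhat; rw [D.Ehat_periodic, D.areg_periodic, D.phi_periodic]

/-- The slice of `F̂ + m²` is smooth. [folklore] -/
theorem contDiff_phi_slice (k : Fin d → ℝ) (j : Fin d) {n : WithTop ℕ∞} :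
    ContDiff ℝ n fun s => D.phi (Function.update k j s) := by
  unfold phi Fhat
  exact (contDiff_trigSum_slice _ _ _ k j).add contDiff_const

/-- The slice of `Ê` is smooth. [folklore] -/
theorem contDiff_Ehat_slice (k : Fin d → ℝ) (j : Fin d) {n : WithTop ℕ∞} :
    ContDiff ℝ n fun s => D.Ehat (Function.update k j s) :=
  contDiff_trigSum_slice _ _ _ k j

/-- The slice of `Â + λm²` is smooth. [folklore] -/
theorem contDiff_areg_slice (k : Fin d → ℝ) (j : Fin d) {n : WithTop ℕ∞} :
    ContDiff ℝ n fun s => D.areg (Function.update k j s) := by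
  unfold areg Ahat
  exact (contDiff_trigSum_slice _ _ _ k j).add contDiff_const

end Data

namespace Data

variable {K₁ K₂ ρ : ℝ} (D : Data d K₁ K₂ ρ)

/-! ### Elementary bounds: coefficients, `F̂`, `F''`, `λ` -/

/-- Finite sums against `F` are the corresponding lattice sums (finite support). [folklore] -/
theorem sum_mul_eq_tsum (g : Site d → ℝ) : ∑ x ∈ D.S, g x * D.F x = ∑' x, g x * D.F x := by
  rw [tsum_eq_sum (s := D.S) fun x hx => by rw [D.support x hx, mul_zero]]

/-- `Σ_x F(x) = 0` as a series (finite support). [cite: LiuSlade2024, Theorem 1.2 (the critical case `μ_c`: F̂(0) = Σ_x F(x) = 0)] -/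
theorem tsum_F_eq_zero : ∑' x, D.F x = 0 := by
  rw [tsum_eq_sum (s := D.S) fun x hx => D.support x hx]
  exact D.sum_eq_zero

/-- **Bridge to the tree's `F''`**: `D.Fpp = ls24Fpp D.F`, the constant `F'' = -Σ_x|x|²F(x)` of
(1.10) as vendored in `LaceExpansionGaussianDeconvolution.lean` (series form). [cite: LiuSlade2024, (1.10)] -/
theorem Fpp_eq_ls24Fpp : D.Fpp = ls24Fpp D.F := by
  unfold Fpp ls24Fpp
  rw [D.sum_mul_eq_tsum]

/-- In the critical case the tree's `μ = 1 - λF̂(0)` of (1.12) is `1`. [cite: LiuSlade2024, (1.12)] -/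
theorem ls24Mu_eq_one : ls24Mu D.F = 1 := ls24Mu_of_tsum_eq_zero D.tsum_F_eq_zero

/-- **Bridge to the tree's `λ`**: `D.lam = ls24Lambda D.F`, the constant `λ = 1/(F̂(0) + F'')` of
(1.12) as vendored in `LaceExpansionGaussianDeconvolution.lean` (here `F̂(0) = Σ_x F(x) = 0`).
[cite: LiuSlade2024, (1.12)] -/
theorem lam_eq_ls24Lambda : D.lam = ls24Lambda D.F := by
  rw [ls24Lambda_of_tsum_eq_zero D.tsum_F_eq_zero, lam, Fpp_eq_ls24Fpp]

/-- **Bridge to the tree's `E`**: `D.Efun x = A_μ(x) - λF(x)` with the tree's constants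
`μ = ls24Mu D.F` (`= 1`) and `λ = ls24Lambda D.F` of (1.12) — definitionally the tree's
`ls24E D.F x` (`LaceExpansionGaussianDeconvolutionProp24Analysis.lean`, sub-namespace
`LiuSlade2024Prop24`; stated against its definiens to keep this file's imports small).
[cite: LiuSlade2024, §2.1 (E_{λ,μ} = A_μ - λF)] -/
theorem Efun_eq_lsA_sub (x : Site d) : D.Efun x = lsA d (ls24Mu D.F) x - ls24Lambda D.F * D.F x := by
  rw [Efun, ls24Mu_eq_one, lam_eq_ls24Lambda]

/-- `K₁ ≥ 0` (from the decay bound at `x = 0`). [folklore] -/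
theorem K₁_nonneg (D : Data d K₁ K₂ ρ) : 0 ≤ K₁ := by
  have h := D.decay 0
  rw [jnorm_zero, Real.one_rpow, mul_one] at h
  exact (abs_nonneg _).trans h

/-- The decay of the coefficients of `∂_j^n F̂`: `|F(x) x_j^n| ≤ K₁ ⟦x⟧^{-(d+2+ρ-n)}`. [cite: LiuSlade2024, proof of Lemma 2.5 ("with h(x) = x^γ F(x) and b = -|γ| + d + 2 + ρ")] -/
theorem abs_coeff_le (j : Fin d) (n : ℕ) (x : Site d) :
    |D.F x * ((x j : ℤ) : ℝ) ^ n| ≤ K₁ * jnorm x ^ (-((d : ℝ) + 2 + ρ - n)) := by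
  rw [abs_mul, abs_pow]
  have h1 : |((x j : ℤ) : ℝ)| ^ n ≤ jnorm x ^ (n : ℝ) := by
    rw [Real.rpow_natCast]
    exact pow_le_pow_left₀ (abs_nonneg _) ((abs_apply_le_euclidNorm x j).trans (euclidNorm_le_jnorm x)) n
  calc |D.F x| * |((x j : ℤ) : ℝ)| ^ n ≤ K₁ * jnorm x ^ (-((d : ℝ) + 2 + ρ)) * jnorm x ^ (n : ℝ) :=
        mul_le_mul (D.decay x) h1 (by positivity) (mul_nonneg D.K₁_nonneg (Real.rpow_nonneg (jnorm_pos x).le _))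
    _ = K₁ * jnorm x ^ (-((d : ℝ) + 2 + ρ - n)) := by
        rw [mul_assoc, ← Real.rpow_add (jnorm_pos x)]; ring_nf

/-- **`∂_j^n F̂` for `n < 2 + ρ` is bounded**: `|∂_j^n F̂(k)| ≤ K₁ Σ_x ⟦x⟧^{-(d+2+ρ-n)}`.
[cite: LiuSlade2024, proof of Lemma 2.5 ("If 2 ≤ |γ| < 2 + ρ then b > d, and Lemma 2.6(i) gives F̂_γ ∈ L^∞")] -/
theorem abs_dj_Fhat_le (j : Fin d) {n : ℕ} (hn : (n : ℝ) < 2 + ρ) (k : Fin d → ℝ) :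
    |dj j n D.Fhat k| ≤ K₁ * jsum d ((d : ℝ) + 2 + ρ - n) := by
  unfold Fhat
  rw [dj_trigSum]
  exact abs_trigSum_le_of_decay _ D.K₁_nonneg (by linarith) (fun x _ => D.abs_coeff_le j n x) _ k

/-- `|F̂(k)| ≤ K₁ Σ_x ⟦x⟧^{-(d+2+ρ)}`. [cite: LiuSlade2024, Lemma 2.6 (i)] -/
theorem abs_Fhat_le (hρ : 0 < ρ) (k : Fin d → ℝ) : |D.Fhat k| ≤ K₁ * jsum d ((d : ℝ) + 2 + ρ) := by
  unfold Fhat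
  refine abs_trigSum_le_of_decay _ D.K₁_nonneg (by linarith) (fun x _ => ?_) _ k
  exact D.decay x

end Data

/-- `|k·x| ≤ d ⟦x⟧ ‖k‖_∞`. [folklore] -/
theorem abs_kdot_le_mul_jnorm (k : Fin d → ℝ) (x : Site d) : |kdot k x| ≤ d * jnorm x * ‖k‖ := by
  unfold kdot
  calc |∑ i, k i * ((x i : ℤ) : ℝ)| ≤ ∑ i, |k i * ((x i : ℤ) : ℝ)| := abs_sum_le_sum_abs _ _
    _ ≤ ∑ _i : Fin d, ‖k‖ * jnorm x := by
        refine sum_le_sum fun i _ => ?_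
        rw [abs_mul]
        exact mul_le_mul (abs_apply_le_norm k i)
          ((abs_apply_le_euclidNorm x i).trans (euclidNorm_le_jnorm x)) (abs_nonneg _) (norm_nonneg _)
    _ = d * jnorm x * ‖k‖ := by
        rw [sum_const, card_univ, Fintype.card_fin, nsmul_eq_mul]; ring

/-- **The first slice derivative of a cosine sum vanishes at `k = 0`, quantitatively**: if
`|c(x)| ≤ K⟦x⟧^{-(b+2)}` with `b > d` then `|∂_j Σ_x c(x)cos(k·x)| ≤ d K (Σ_x ⟦x⟧^{-b}) ‖k‖_∞`
(`∂_j Σ c cos(k·x) = -Σ c(x) x_j sin(k·x)` and `|sin(k·x)| ≤ |k·x| ≤ d⟦x⟧‖k‖_∞`).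
[cite: LiuSlade2024, proof of Lemma 2.5 ("If |γ| = 1, by Taylor's theorem and symmetry … |F̂_γ(k)| ≲ |k|")] -/
theorem abs_dj_one_trigSum_le (S : Finset (Site d)) {c : Site d → ℝ} {K b : ℝ} (hK : 0 ≤ K)
    (hb : (d : ℝ) < b) (hc : ∀ x ∈ S, |c x| ≤ K * jnorm x ^ (-(b + 2))) (j : Fin d) (k : Fin d → ℝ) :
    |dj j 1 (trigSum S c 0) k| ≤ d * K * jsum d b * ‖k‖ := by
  rw [dj_trigSum]
  unfold trigSum
  have hterm : ∀ x ∈ S, |c x * ((x j : ℤ) : ℝ) ^ 1 * Real.cos (kdot k x + (0 + (1 : ℕ) * (π / 2)))| ≤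
      d * K * ‖k‖ * jnorm x ^ (-b) := by
    intro x hx
    rw [pow_one, Nat.cast_one, one_mul, zero_add, Real.cos_add_pi_div_two, abs_mul, abs_mul, abs_neg]
    have h1 : |Real.sin (kdot k x)| ≤ d * jnorm x * ‖k‖ := (Real.abs_sin_le_abs).trans (abs_kdot_le_mul_jnorm k x)
    have h2 : |((x j : ℤ) : ℝ)| ≤ jnorm x := (abs_apply_le_euclidNorm x j).trans (euclidNorm_le_jnorm x)
    have h3 := hc x hx
    have hj0 : 0 < jnorm x := jnorm_pos x
    calc |c x| * |((x j : ℤ) : ℝ)| * |Real.sin (kdot k x)|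
        ≤ (K * jnorm x ^ (-(b + 2))) * jnorm x * (d * jnorm x * ‖k‖) := by
          have hK' : 0 ≤ K * jnorm x ^ (-(b + 2)) := mul_nonneg hK (Real.rpow_nonneg hj0.le _)
          exact mul_le_mul (mul_le_mul h3 h2 (abs_nonneg _) hK') h1 (abs_nonneg _) (by positivity)
      _ = d * K * ‖k‖ * (jnorm x ^ (-(b + 2)) * jnorm x ^ (2 : ℝ)) := by
          rw [Real.rpow_two]; ring
      _ = d * K * ‖k‖ * jnorm x ^ (-b) := by
          rw [← Real.rpow_add hj0]; ring_nf
  calc |∑ x ∈ S, c x * ((x j : ℤ) : ℝ) ^ 1 * Real.cos (kdot k x + (0 + (1 : ℕ) * (π / 2)))|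
      ≤ ∑ x ∈ S, |c x * ((x j : ℤ) : ℝ) ^ 1 * Real.cos (kdot k x + (0 + (1 : ℕ) * (π / 2)))| :=
        abs_sum_le_sum_abs _ _
    _ ≤ ∑ x ∈ S, d * K * ‖k‖ * jnorm x ^ (-b) := sum_le_sum hterm
    _ = d * K * ‖k‖ * ∑ x ∈ S, jnorm x ^ (-b) := by rw [mul_sum]
    _ ≤ d * K * ‖k‖ * jsum d b := by
        refine mul_le_mul_of_nonneg_left ((summable_jnorm_rpow_neg hb).sum_le_tsum _
          fun x _ => Real.rpow_nonneg (jnorm_pos x).le _) (by positivity)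
    _ = d * K * jsum d b * ‖k‖ := by ring

namespace Data

variable {K₁ K₂ ρ : ℝ} (D : Data d K₁ K₂ ρ)

/-- **`|∂_j F̂(k)| ≤ d K₁ (Σ_x ⟦x⟧^{-(d+ρ)}) ‖k‖_∞`.** [cite: LiuSlade2024, proof of Lemma 2.5 ("If |γ| = 1 … |F̂_γ(k)| ≲ |k|")] -/
theorem abs_dj_one_Fhat_le (hρ : 0 < ρ) (j : Fin d) (k : Fin d → ℝ) :
    |dj j 1 D.Fhat k| ≤ d * K₁ * jsum d ((d : ℝ) + ρ) * ‖k‖ := by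
  unfold Fhat
  refine abs_dj_one_trigSum_le D.S D.K₁_nonneg (by linarith) (fun x _ => ?_) j k
  have := D.decay x
  rwa [show -((d : ℝ) + 2 + ρ) = -(((d : ℝ) + ρ) + 2) by ring] at this

end Data

namespace Data

variable {K₁ K₂ ρ : ℝ} (D : Data d K₁ K₂ ρ)

/-! ### `F'' ≥ 2dK₂` (Liu–Slade's (1.10)) and the constant `λ` -/

/-- One coordinate of (1.10): `Σ_x x_j² F(x) ≤ -2K₂` for every axis `j` (`ρ > 0`). From the
infrared bound at `k = εe_j`, `Σ_x F(x) = 0` and the Taylor bound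
`|1 - cos t - t²/2| ≤ (5/2)|t|^{2+θ}` (`θ = (ρ/2) ∧ 2`):
`K₂ε² ≤ Σ_x F(x)(cos(εx_j) - 1) ≤ -(ε²/2)Σ_x x_j²F(x) + (5/2)K₁(Σ⟦x⟧^{-(d+ρ-θ)})ε^{2+θ}`,
then `ε → 0`. [cite: LiuSlade2024, (1.10) ("By Taylor's Theorem and Assumption 1.1, F'' = -Σ|x|²F(x) ∈ [2dK₂, ∞)")] -/
theorem sum_sq_mul_F_le (hρ : 0 < ρ) (j : Fin d) :
    ∑ x ∈ D.S, ((x j : ℤ) : ℝ) ^ 2 * D.F x ≤ -2 * K₂ := by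
  set θ : ℝ := min (ρ / 2) 2 with hθ
  have hθ0 : 0 < θ := by rw [hθ]; exact lt_min (by linarith) (by norm_num)
  have hθ2 : θ ≤ 2 := min_le_right _ _
  have hθρ : θ < ρ := lt_of_le_of_lt (min_le_left _ _) (by linarith)
  set M : ℝ := ∑ x ∈ D.S, ((x j : ℤ) : ℝ) ^ 2 * D.F x with hM
  set C : ℝ := 5 / 2 * K₁ * jsum d ((d : ℝ) + ρ - θ) with hC
  have hK₁ := D.K₁_nonneg
  have hC0 : 0 ≤ C := by have := jsum_nonneg d ((d : ℝ) + ρ - θ); positivity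
  -- the inequality at scale `ε ∈ (0, 1]`
  have hε : ∀ ε : ℝ, 0 < ε → ε ≤ 1 → K₂ ≤ -M / 2 + C * ε ^ θ := by
    intro ε hε0 hε1
    have hk : ‖(Pi.single j ε : Fin d → ℝ)‖ ≤ π + 1 := by
      rw [Pi.norm_single, Real.norm_eq_abs, abs_of_pos hε0]; linarith [Real.pi_gt_three]
    have hir := D.infrared (Pi.single j ε) hk
    rw [Pi.norm_single, Real.norm_eq_abs, abs_of_pos hε0] at hir
    -- `F̂(εe_j) = Σ F(x)(cos(εx_j) - 1) = -(ε²/2) M + R`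
    have hF : trigSum D.S D.F 0 (Pi.single j ε) =
        -(ε ^ 2 / 2) * M - ∑ x ∈ D.S, D.F x * (1 - Real.cos (ε * ((x j : ℤ) : ℝ)) - (ε * ((x j : ℤ) : ℝ)) ^ 2 / 2) := by
      unfold trigSum
      simp only [kdot_single, add_zero]
      rw [hM, mul_sum, ← sub_eq_zero]
      have h0 : ∑ x ∈ D.S, D.F x = 0 := D.sum_eq_zero
      have : ∑ x ∈ D.S, D.F x * Real.cos (ε * ((x j : ℤ) : ℝ)) -
          (∑ x ∈ D.S, -(ε ^ 2 / 2) * (((x j : ℤ) : ℝ) ^ 2 * D.F x) -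
            ∑ x ∈ D.S, D.F x * (1 - Real.cos (ε * ((x j : ℤ) : ℝ)) - (ε * ((x j : ℤ) : ℝ)) ^ 2 / 2)) =
          ∑ x ∈ D.S, D.F x := by
        rw [← sum_sub_distrib, ← sum_sub_distrib]
        refine sum_congr rfl fun x _ => ?_
        ring
      rw [this, h0]
    -- the Taylor remainder
    have hR : |∑ x ∈ D.S, D.F x * (1 - Real.cos (ε * ((x j : ℤ) : ℝ)) - (ε * ((x j : ℤ) : ℝ)) ^ 2 / 2)| ≤
        C * ε ^ (2 + θ) := by
      have hterm : ∀ x ∈ D.S, |D.F x * (1 - Real.cos (ε * ((x j : ℤ) : ℝ)) - (ε * ((x j : ℤ) : ℝ)) ^ 2 / 2)| ≤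
          5 / 2 * K₁ * ε ^ (2 + θ) * jnorm x ^ (-((d : ℝ) + ρ - θ)) := by
        intro x _
        rw [abs_mul]
        have h1 := abs_one_sub_cos_sub_sq_le (ε * ((x j : ℤ) : ℝ)) hθ0.le hθ2
        have h2 : |ε * ((x j : ℤ) : ℝ)| ^ (2 + θ) ≤ ε ^ (2 + θ) * jnorm x ^ (2 + θ) := by
          rw [abs_mul, abs_of_pos hε0, Real.mul_rpow hε0.le (abs_nonneg _)]
          exact mul_le_mul_of_nonneg_left (Real.rpow_le_rpow (abs_nonneg _)
            ((abs_apply_le_euclidNorm x j).trans (euclidNorm_le_jnorm x)) (by linarith))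
            (Real.rpow_nonneg hε0.le _)
        have h3 := D.decay x
        have hj0 := jnorm_pos x
        calc |D.F x| * |1 - Real.cos (ε * ((x j : ℤ) : ℝ)) - (ε * ((x j : ℤ) : ℝ)) ^ 2 / 2|
            ≤ (K₁ * jnorm x ^ (-((d : ℝ) + 2 + ρ))) * (5 / 2 * (ε ^ (2 + θ) * jnorm x ^ (2 + θ))) :=
              mul_le_mul h3 (h1.trans (mul_le_mul_of_nonneg_left h2 (by norm_num))) (abs_nonneg _)
                (mul_nonneg hK₁ (Real.rpow_nonneg hj0.le _))
          _ = 5 / 2 * K₁ * ε ^ (2 + θ) * (jnorm x ^ (-((d : ℝ) + 2 + ρ)) * jnorm x ^ (2 + θ)) := by ring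
          _ = 5 / 2 * K₁ * ε ^ (2 + θ) * jnorm x ^ (-((d : ℝ) + ρ - θ)) := by
              rw [← Real.rpow_add hj0]; ring_nf
      calc |∑ x ∈ D.S, D.F x * (1 - Real.cos (ε * ((x j : ℤ) : ℝ)) - (ε * ((x j : ℤ) : ℝ)) ^ 2 / 2)|
          ≤ ∑ x ∈ D.S, |D.F x * (1 - Real.cos (ε * ((x j : ℤ) : ℝ)) - (ε * ((x j : ℤ) : ℝ)) ^ 2 / 2)| :=
            abs_sum_le_sum_abs _ _
        _ ≤ ∑ x ∈ D.S, 5 / 2 * K₁ * ε ^ (2 + θ) * jnorm x ^ (-((d : ℝ) + ρ - θ)) := sum_le_sum hterm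
        _ = 5 / 2 * K₁ * ε ^ (2 + θ) * ∑ x ∈ D.S, jnorm x ^ (-((d : ℝ) + ρ - θ)) := by rw [mul_sum]
        _ ≤ 5 / 2 * K₁ * ε ^ (2 + θ) * jsum d ((d : ℝ) + ρ - θ) := by
            refine mul_le_mul_of_nonneg_left ((summable_jnorm_rpow_neg (by linarith)).sum_le_tsum _
              fun x _ => Real.rpow_nonneg (jnorm_pos x).le _) (by positivity)
        _ = C * ε ^ (2 + θ) := by rw [hC]; ring
    -- combine and divide by `ε²`
    have h1 : K₂ * ε ^ 2 ≤ -(ε ^ 2 / 2) * M + C * ε ^ (2 + θ) := by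
      have := (abs_le.1 hR).1
      rw [hF] at hir
      linarith
    have hε2 : 0 < ε ^ 2 := by positivity
    have h2 : C * ε ^ (2 + θ) = (C * ε ^ θ) * ε ^ 2 := by
      rw [Real.rpow_add hε0, Real.rpow_two]; ring
    rw [h2] at h1
    have h3 : K₂ * ε ^ 2 ≤ (-M / 2 + C * ε ^ θ) * ε ^ 2 := by linarith
    exact le_of_mul_le_mul_right h3 hε2
  -- let `ε → 0⁺`
  have hlim : Tendsto (fun ε : ℝ => -M / 2 + C * ε ^ θ) (𝓝[>] 0) (𝓝 (-M / 2)) := by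
    have h0 : Tendsto (fun ε : ℝ => -M / 2 + C * ε ^ θ) (𝓝 0) (𝓝 (-M / 2 + C * (0 : ℝ) ^ θ)) :=
      ((Real.continuous_rpow_const hθ0.le).continuousAt.tendsto.const_mul C).const_add _
    rw [Real.zero_rpow hθ0.ne', mul_zero, add_zero] at h0
    exact h0.mono_left nhdsWithin_le_nhds
  have hev : ∀ᶠ ε in 𝓝[>] (0 : ℝ), K₂ ≤ -M / 2 + C * ε ^ θ := by
    filter_upwards [Ioo_mem_nhdsGT (zero_lt_one' ℝ)] with ε h using hε ε h.1 h.2.le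
  have := ge_of_tendsto hlim hev
  linarith

end Data

namespace Data

variable {K₁ K₂ ρ : ℝ} (D : Data d K₁ K₂ ρ)

/-- **(1.10): `F'' ≥ 2dK₂`** (summing `Σ_x x_j²F(x) ≤ -2K₂` over the `d` axes; sup-norm
normalisation of `K₂`). [cite: LiuSlade2024, (1.10)] -/
theorem le_Fpp (hρ : 0 < ρ) : 2 * d * K₂ ≤ D.Fpp := by
  have h : ∑ x ∈ D.S, euclidNorm x ^ 2 * D.F x = ∑ j : Fin d, ∑ x ∈ D.S, ((x j : ℤ) : ℝ) ^ 2 * D.F x := by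
    rw [sum_comm]
    refine sum_congr rfl fun x _ => ?_
    rw [euclidNorm_sq, sum_mul]
  unfold Fpp
  rw [h]
  have := sum_le_sum fun j (_ : j ∈ (univ : Finset (Fin d))) => D.sum_sq_mul_F_le hρ j
  rw [sum_const, card_univ, Fintype.card_fin, nsmul_eq_mul] at this
  linarith

/-- `F'' ≤ K₁ Σ_x ⟦x⟧^{-(d+ρ)}`. [cite: LiuSlade2024, (1.10)] -/
theorem Fpp_le (hρ : 0 < ρ) : D.Fpp ≤ K₁ * jsum d ((d : ℝ) + ρ) := by
  unfold Fpp
  have hK₁ := D.K₁_nonneg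
  calc -∑ x ∈ D.S, euclidNorm x ^ 2 * D.F x ≤ |∑ x ∈ D.S, euclidNorm x ^ 2 * D.F x| := neg_le_abs _
    _ ≤ ∑ x ∈ D.S, |euclidNorm x ^ 2 * D.F x| := abs_sum_le_sum_abs _ _
    _ ≤ ∑ x ∈ D.S, K₁ * jnorm x ^ (-((d : ℝ) + ρ)) := by
        refine sum_le_sum fun x _ => ?_
        rw [abs_mul, abs_of_nonneg (sq_nonneg _)]
        have hj0 := jnorm_pos x
        calc euclidNorm x ^ 2 * |D.F x| ≤ jnorm x ^ (2 : ℝ) * (K₁ * jnorm x ^ (-((d : ℝ) + 2 + ρ))) := by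
              rw [Real.rpow_two]
              exact mul_le_mul (pow_le_pow_left₀ (euclidNorm_nonneg x) (euclidNorm_le_jnorm x) 2)
                (D.decay x) (abs_nonneg _) (by positivity)
          _ = K₁ * (jnorm x ^ (2 : ℝ) * jnorm x ^ (-((d : ℝ) + 2 + ρ))) := by ring
          _ = K₁ * jnorm x ^ (-((d : ℝ) + ρ)) := by rw [← Real.rpow_add hj0]; ring_nf
    _ = K₁ * ∑ x ∈ D.S, jnorm x ^ (-((d : ℝ) + ρ)) := by rw [mul_sum]
    _ ≤ K₁ * jsum d ((d : ℝ) + ρ) :=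
        mul_le_mul_of_nonneg_left ((summable_jnorm_rpow_neg (by linarith)).sum_le_tsum _
          fun x _ => Real.rpow_nonneg (jnorm_pos x).le _) hK₁

/-- `F'' > 0` (`d ≥ 1`, `K₂ > 0`). [cite: LiuSlade2024, (1.10)] -/
theorem Fpp_pos (hd : 1 ≤ d) (hK₂ : 0 < K₂) (hρ : 0 < ρ) : 0 < D.Fpp := by
  have h := D.le_Fpp hρ
  have : (0 : ℝ) < 2 * d * K₂ := by
    have : (1 : ℝ) ≤ d := by exact_mod_cast hd
    positivity
  linarith

/-- `λ > 0`. [cite: LiuSlade2024, (1.12) ("By hypothesis, λ > 0")] -/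
theorem lam_pos (hd : 1 ≤ d) (hK₂ : 0 < K₂) (hρ : 0 < ρ) : 0 < D.lam :=
  inv_pos.2 (D.Fpp_pos hd hK₂ hρ)

/-- **`λ ≤ 1/(2dK₂)`.** [cite: LiuSlade2024, (1.10) and (1.12)] -/
theorem lam_le (hd : 1 ≤ d) (hK₂ : 0 < K₂) (hρ : 0 < ρ) : D.lam ≤ 1 / (2 * d * K₂) := by
  unfold lam
  rw [one_div]
  have : (0 : ℝ) < 2 * d * K₂ := by
    have : (1 : ℝ) ≤ d := by exact_mod_cast hd
    positivity
  exact inv_anti₀ this (D.le_Fpp hρ)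

/-- `λ ≥ 1/(K₁ Σ⟦x⟧^{-(d+ρ)})`-type lower bound in the form `λ · (K₁ Σ_x ⟦x⟧^{-(d+ρ)}) ≥ 1`.
[cite: LiuSlade2024, (1.10) and (1.12)] -/
theorem one_le_lam_mul (hd : 1 ≤ d) (hK₂ : 0 < K₂) (hρ : 0 < ρ) :
    1 ≤ D.lam * (K₁ * jsum d ((d : ℝ) + ρ)) := by
  unfold lam
  rw [← div_eq_inv_mul, one_le_div (D.Fpp_pos hd hK₂ hρ)]
  exact D.Fpp_le hρ

/-! ### The regularised denominator `Â + λm²` and the identity `f̂ = 1/φ - λ/a` -/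

/-- `Â + λm² ≥ Â ≥ 0`, indeed `> 0`. [folklore] -/
theorem areg_pos (hd : 1 ≤ d) (hK₂ : 0 < K₂) (hρ : 0 < ρ) (k : Fin d → ℝ) : 0 < D.areg k := by
  unfold areg
  have h1 := Ahat_nonneg hd k
  have h2 : 0 < D.lam * D.m ^ 2 := mul_pos (D.lam_pos hd hK₂ hρ) (pow_pos D.m_pos 2)
  linarith

/-- **The infrared bound for `Â + λm²`**: `c_A‖k‖² ≤ Â(k) + λm²` for `‖k‖ ≤ π + 1`.
[cite: LiuSlade2024, (1.11)] -/
theorem mul_norm_sq_le_areg (hd : 1 ≤ d) (hK₂ : 0 < K₂) (hρ : 0 < ρ) {k : Fin d → ℝ}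
    (hk : ‖k‖ ≤ π + 1) : cA d * ‖k‖ ^ 2 ≤ D.areg k := by
  unfold areg
  have h1 := cA_mul_norm_sq_le_Ahat hd hk
  have h2 : 0 ≤ D.lam * D.m ^ 2 := (mul_pos (D.lam_pos hd hK₂ hρ) (pow_pos D.m_pos 2)).le
  linarith

/-- `Â + λm² ≤ 2 + 1/(2dK₂)`. [cite: LiuSlade2024, (1.11)] -/
theorem areg_le (hd : 1 ≤ d) (hK₂ : 0 < K₂) (hρ : 0 < ρ) (k : Fin d → ℝ) :
    D.areg k ≤ 2 + 1 / (2 * d * K₂) := by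
  unfold areg
  have h1 := Ahat_le_two hd k
  have h2 : D.lam * D.m ^ 2 ≤ 1 / (2 * d * K₂) := by
    calc D.lam * D.m ^ 2 ≤ D.lam * 1 := by
          refine mul_le_mul_of_nonneg_left ?_ (D.lam_pos hd hK₂ hρ).le
          have := D.m_le_one; have := D.m_pos; nlinarith
      _ ≤ 1 / (2 * d * K₂) := by rw [mul_one]; exact D.lam_le hd hK₂ hρ
  linarith

/-- **`f̂_m = 1/(F̂ + m²) - λ/(Â + λm²)`** (because `(Â + λm²) - λ(F̂ + m²) = Ê`).
[cite: LiuSlade2024, §2.1 ("f̂ = ĈÊĜ", "G = λC + f")] -/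
theorem fhat_eq (hd : 1 ≤ d) (hK₂ : 0 < K₂) (hρ : 0 < ρ) (k : Fin d → ℝ) :
    D.fhat k = (D.phi k)⁻¹ - D.lam * (D.areg k)⁻¹ := by
  have ha := (D.areg_pos hd hK₂ hρ k).ne'
  have hp := (D.phi_pos hK₂.le k).ne'
  unfold fhat
  rw [D.Ehat_eq]
  have hE : Ahat d k - D.lam * D.Fhat k = D.areg k - D.lam * D.phi k := by
    unfold areg phi; ring
  rw [hE]
  field_simp

/-- The slice of `f̂_m` is smooth. [folklore] -/
theorem contDiff_fhat_slice (hd : 1 ≤ d) (hK₂ : 0 < K₂) (hρ : 0 < ρ) (k : Fin d → ℝ) (j : Fin d)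
    {n : WithTop ℕ∞} : ContDiff ℝ n fun s => D.fhat (Function.update k j s) := by
  unfold fhat
  exact (D.contDiff_Ehat_slice k j).div ((D.contDiff_areg_slice k j).mul (D.contDiff_phi_slice k j))
    fun s => mul_ne_zero (D.areg_pos hd hK₂ hρ _).ne' (D.phi_pos hK₂.le _).ne'

/-! ### The lattice function `E`: support and decay -/

/-- `E` vanishes off `ES`. [folklore] -/
theorem Efun_eq_zero {x : Site d} (hx : x ∉ D.ES) : D.Efun x = 0 := by
  unfold Efun
  have hxn : x ∉ nnSet d := fun h => hx (mem_union_left _ h)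
  have hxS : x ∉ D.S := fun h => hx (mem_union_right _ h)
  have hx0 : x ≠ 0 := fun h => hxn (by rw [h, nnSet]; exact mem_insert_self _ _)
  have hxnb : x ∉ (zdGraph d).neighborFinset 0 := fun h => hxn (by rw [nnSet]; exact mem_insert_of_mem h)
  rw [lsA_one, delta0_of_ne_zero hx0, srwStep_of_not_mem hxnb, D.support x hxS]; ring

/-- `|A_1(x)| ≤ ⟦x⟧^{-b}` for every `b` (`A_1` lives where `⟦x⟧ = 1` and `|A_1| ≤ 1`, `d ≥ 1`).
[cite: LiuSlade2024, §2.1 (A_1 = δ - D_nn)] -/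
theorem _root_.Literature.Barriers.CriticalPhenomena.SpreadOutIsing.LS24.abs_lsA_one_le
    (hd : 1 ≤ d) (b : ℝ) (x : Site d) : |lsA d 1 x| ≤ jnorm x ^ (-b) := by
  rw [lsA_one]
  by_cases hx0 : x = 0
  · subst hx0
    rw [delta0_zero, jnorm_zero, Real.one_rpow, show srwStep d 0 = 0 from if_neg (SimpleGraph.irrefl _)]
    simp
  rw [delta0_of_ne_zero hx0, zero_sub, abs_neg]
  by_cases hxn : x ∈ (zdGraph d).neighborFinset 0
  · have hadj : (zdGraph d).Adj 0 x := (SimpleGraph.mem_neighborFinset _ _ _).1 hxn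
    have hval : srwStep d x = 1 / (2 * d) := if_pos hadj
    have hj : jnorm x = 1 := by
      obtain ⟨i, h | h⟩ := (zdGraph_adj_iff 0 x).1 hadj
      · rw [zero_add] at h
        rw [h, jnorm, euclidNorm_single]; simp
      · have hx : x = -Pi.single i 1 := by
          have := congrArg (fun y => y - Pi.single i (1 : ℤ)) h
          simpa using this.symm
        rw [hx, jnorm, euclidNorm_neg, euclidNorm_single]; simp
    rw [hj, Real.one_rpow, hval, abs_of_nonneg (by positivity)]
    have : (1 : ℝ) ≤ d := by exact_mod_cast hd
    rw [div_le_one (by positivity)]; linarith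
  · rw [srwStep_of_not_mem hxn, abs_zero]
    exact Real.rpow_nonneg (jnorm_pos x).le _

/-- **The decay of `E`**: `|E(x)| ≤ (1 + λK₁)⟦x⟧^{-(d+2+ρ)}` ("`E = A - λF` has the same
`|x|^{-(d+2+ρ)}` decay as `F`"). [cite: LiuSlade2024, proof of Lemma 2.5 ("We use the fact that E = A - λF has the same decay as F")] -/
theorem abs_Efun_le (hd : 1 ≤ d) (hK₂ : 0 < K₂) (hρ : 0 < ρ) (x : Site d) :
    |D.Efun x| ≤ (1 + D.lam * K₁) * jnorm x ^ (-((d : ℝ) + 2 + ρ)) := by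
  unfold Efun
  have h1 := abs_lsA_one_le hd ((d : ℝ) + 2 + ρ) x
  have h2 := D.decay x
  have hl := (D.lam_pos hd hK₂ hρ).le
  calc |lsA d 1 x - D.lam * D.F x| ≤ |lsA d 1 x| + |D.lam * D.F x| := abs_sub _ _
    _ ≤ jnorm x ^ (-((d : ℝ) + 2 + ρ)) + D.lam * (K₁ * jnorm x ^ (-((d : ℝ) + 2 + ρ))) := by
        rw [abs_mul, abs_of_nonneg hl]
        exact add_le_add h1 (mul_le_mul_of_nonneg_left h2 hl)
    _ = (1 + D.lam * K₁) * jnorm x ^ (-((d : ℝ) + 2 + ρ)) := by ring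

/-- The uniform decay constant of `E`: `1 + λK₁ ≤ 1 + K₁/(2dK₂)`. [cite: LiuSlade2024, proof of Lemma 2.5] -/
theorem one_add_lam_mul_le (hd : 1 ≤ d) (hK₂ : 0 < K₂) (hρ : 0 < ρ) :
    1 + D.lam * K₁ ≤ 1 + K₁ / (2 * d * K₂) := by
  have h := mul_le_mul_of_nonneg_right (D.lam_le hd hK₂ hρ) D.K₁_nonneg
  rw [one_div, ← div_eq_inv_mul] at h
  linarith

/-- The decay of the coefficients of `∂_j^n Ê`: `|E(x) x_j^n| ≤ (1 + K₁/(2dK₂)) ⟦x⟧^{-(d+2+ρ-n)}`.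
[cite: LiuSlade2024, proof of Lemma 2.5] -/
theorem abs_Ecoeff_le (hd : 1 ≤ d) (hK₂ : 0 < K₂) (hρ : 0 < ρ) (j : Fin d) (n : ℕ) (x : Site d) :
    |D.Efun x * ((x j : ℤ) : ℝ) ^ n| ≤ (1 + K₁ / (2 * d * K₂)) * jnorm x ^ (-((d : ℝ) + 2 + ρ - n)) := by
  rw [abs_mul, abs_pow]
  have hj0 := jnorm_pos x
  have h1 : |((x j : ℤ) : ℝ)| ^ n ≤ jnorm x ^ (n : ℝ) := by
    rw [Real.rpow_natCast]
    exact pow_le_pow_left₀ (abs_nonneg _) ((abs_apply_le_euclidNorm x j).trans (euclidNorm_le_jnorm x)) n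
  have hK := D.one_add_lam_mul_le hd hK₂ hρ
  have hK0 : 0 ≤ 1 + D.lam * K₁ := by
    have := (D.lam_pos hd hK₂ hρ).le; have := D.K₁_nonneg; positivity
  calc |D.Efun x| * |((x j : ℤ) : ℝ)| ^ n
      ≤ ((1 + D.lam * K₁) * jnorm x ^ (-((d : ℝ) + 2 + ρ))) * jnorm x ^ (n : ℝ) :=
        mul_le_mul (D.abs_Efun_le hd hK₂ hρ x) h1 (by positivity) (mul_nonneg hK0 (Real.rpow_nonneg hj0.le _))
    _ = (1 + D.lam * K₁) * jnorm x ^ (-((d : ℝ) + 2 + ρ - n)) := by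
        rw [mul_assoc, ← Real.rpow_add hj0]; ring_nf
    _ ≤ (1 + K₁ / (2 * d * K₂)) * jnorm x ^ (-((d : ℝ) + 2 + ρ - n)) :=
        mul_le_mul_of_nonneg_right hK (Real.rpow_nonneg hj0.le _)

end Data

/-! ## Part 4. Joint smoothness: continuity, linearity and periodicity of `∂_j^n` -/

/-- Phased cosine sums are smooth on `ℝ^d`. [folklore] -/
theorem contDiff_trigSum (S : Finset (Site d)) (c : Site d → ℝ) (θ : ℝ) {n : WithTop ℕ∞} :
    ContDiff ℝ n (trigSum S c θ) := by
  unfold trigSum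
  exact ContDiff.sum fun x _ => contDiff_const.mul (Real.contDiff_cos.comp ((contDiff_kdot x).add contDiff_const))

/-- **Bridge to the Fréchet derivative**: for `ψ ∈ C^N(ℝ^d)` and `n ≤ N`,
`∂_j^n ψ(k) = D^nψ(k)(e_j,…,e_j)` (the tree's `iteratedDeriv_slice_eq_iteratedFDeriv`). [folklore] -/
theorem dj_eq_iteratedFDeriv {ψ : (Fin d → ℝ) → ℝ} {N : WithTop ℕ∞} (hψ : ContDiff ℝ N ψ) {n : ℕ}
    (hn : (n : WithTop ℕ∞) ≤ N) (j : Fin d) (k : Fin d → ℝ) :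
    dj j n ψ k = iteratedFDeriv ℝ n ψ k fun _ => Pi.single j 1 := by
  rw [dj, iteratedDeriv_slice_eq_iteratedFDeriv hψ hn k j (k j), Function.update_eq_self]

/-- Hence `∂_j^n ψ` is continuous on `ℝ^d` for smooth `ψ`. [folklore] -/
theorem continuous_dj {ψ : (Fin d → ℝ) → ℝ} (hψ : ContDiff ℝ (⊤ : ℕ∞) ψ) (j : Fin d) (n : ℕ) :
    Continuous (dj j n ψ) := by
  have h : dj j n ψ = fun k => iteratedFDeriv ℝ n ψ k fun _ => Pi.single j 1 := by
    funext k; exact dj_eq_iteratedFDeriv hψ (by exact_mod_cast le_top) j k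
  rw [h]
  exact (ContinuousMultilinearMap.apply ℝ (fun _ : Fin n => Fin d → ℝ) ℝ fun _ => Pi.single j 1).continuous.comp
    (hψ.continuous_iteratedFDeriv (by exact_mod_cast le_top))

/-- `∂_j^n` of smooth functions is smooth. [folklore] -/
theorem contDiff_dj {ψ : (Fin d → ℝ) → ℝ} (hψ : ContDiff ℝ (⊤ : ℕ∞) ψ) (j : Fin d) (n : ℕ) :
    ContDiff ℝ (⊤ : ℕ∞) (dj j n ψ) := by
  have h : dj j n ψ = fun k => iteratedFDeriv ℝ n ψ k fun _ => Pi.single j 1 := by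
    funext k; exact dj_eq_iteratedFDeriv hψ (by exact_mod_cast le_top) j k
  rw [h]
  have h1 : ContDiff ℝ (⊤ : ℕ∞) (iteratedFDeriv ℝ n ψ) := hψ.iteratedFDeriv_right (by exact_mod_cast le_top)
  exact (ContinuousMultilinearMap.apply ℝ (fun _ : Fin n => Fin d → ℝ) ℝ fun _ => Pi.single j 1).contDiff.comp h1

/-- Linearity: `∂_j^n(aψ) = a ∂_j^n ψ` (slice `C^n`). [folklore] -/
theorem dj_const_mul {j : Fin d} {n : ℕ} {ψ : (Fin d → ℝ) → ℝ} {k : Fin d → ℝ} (a : ℝ)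
    (hψ : ContDiff ℝ n fun s => ψ (Function.update k j s)) :
    dj j n (fun k' => a * ψ k') k = a * dj j n ψ k := by
  unfold dj
  exact iteratedDeriv_const_mul a hψ.contDiffAt

/-- Linearity: `∂_j^n(ψ₁ - ψ₂) = ∂_j^n ψ₁ - ∂_j^n ψ₂` (slices `C^n`). [folklore] -/
theorem dj_sub {j : Fin d} {n : ℕ} {ψ₁ ψ₂ : (Fin d → ℝ) → ℝ} {k : Fin d → ℝ}
    (h₁ : ContDiff ℝ n fun s => ψ₁ (Function.update k j s))
    (h₂ : ContDiff ℝ n fun s => ψ₂ (Function.update k j s)) :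
    dj j n (fun k' => ψ₁ k' - ψ₂ k') k = dj j n ψ₁ k - dj j n ψ₂ k := by
  unfold dj
  exact iteratedDeriv_sub h₁.contDiffAt h₂.contDiffAt

/-- **Periodicity is inherited by `∂_j^n`**: if `ψ` is `2π`-periodic in every coordinate then so
is `∂_j^n ψ`. [folklore] -/
theorem dj_periodic {ψ : (Fin d → ℝ) → ℝ}
    (hper : ∀ (k : Fin d → ℝ) (n : Fin d → ℤ), ψ (fun i => k i + 2 * π * n i) = ψ k)
    (j : Fin d) (r : ℕ) (k : Fin d → ℝ) (n : Fin d → ℤ) :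
    dj j r ψ (fun i => k i + 2 * π * n i) = dj j r ψ k := by
  unfold dj
  have hslice : (fun s => ψ (Function.update (fun i => k i + 2 * π * n i) j s)) =
      fun s => ψ (Function.update k j (s - 2 * π * n j)) := by
    funext s
    have : Function.update (fun i => k i + 2 * π * n i) j s =
        fun i => Function.update k j (s - 2 * π * n j) i + 2 * π * n i := by
      ext i
      by_cases hi : i = j
      · subst hi; simp
      · simp [Function.update_of_ne hi]
    rw [this, hper]
  rw [hslice]
  have h := congrFun (iteratedDeriv_comp_sub_const (n := r) (f := fun s => ψ (Function.update k j s))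
    (s := 2 * π * n j)) (k j + 2 * π * n j)
  simp only [add_sub_cancel_right] at h
  exact h

/-- Periodicity is inherited by `U_u`. [folklore] -/
theorem symDiff_periodic {ψ : (Fin d → ℝ) → ℝ}
    (hper : ∀ (k : Fin d → ℝ) (n : Fin d → ℤ), ψ (fun i => k i + 2 * π * n i) = ψ k)
    (j : Fin d) (u : ℝ) (k : Fin d → ℝ) (n : Fin d → ℤ) :
    symDiff j u ψ (fun i => k i + 2 * π * n i) = symDiff j u ψ k := by
  unfold symDiff
  have h1 : (fun i => k i + 2 * π * n i) + Pi.single j u =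
      fun i => (k + Pi.single j u : Fin d → ℝ) i + 2 * π * n i := by
    ext i; simp only [Pi.add_apply]; ring
  have h2 : (fun i => k i + 2 * π * n i) - Pi.single j u =
      fun i => (k - Pi.single j u : Fin d → ℝ) i + 2 * π * n i := by
    ext i; simp only [Pi.sub_apply]; ring
  rw [h1, h2, hper, hper]

/-- `U_u` preserves continuity. [folklore] -/
theorem continuous_symDiff {ψ : (Fin d → ℝ) → ℝ} (hψ : Continuous ψ) (j : Fin d) (u : ℝ) :
    Continuous (symDiff j u ψ) := by
  unfold symDiff; fun_prop

namespace Data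

variable {K₁ K₂ ρ : ℝ} (D : Data d K₁ K₂ ρ)

/-- `F̂ + m²` is smooth on `ℝ^d`. [folklore] -/
theorem contDiff_phi {n : WithTop ℕ∞} : ContDiff ℝ n D.phi := by
  unfold phi Fhat; exact (contDiff_trigSum _ _ _).add contDiff_const

/-- `Â + λm²` is smooth on `ℝ^d`. [folklore] -/
theorem contDiff_areg {n : WithTop ℕ∞} : ContDiff ℝ n D.areg := by
  unfold areg Ahat; exact (contDiff_trigSum _ _ _).add contDiff_const

/-- `Ê` is smooth on `ℝ^d`. [folklore] -/
theorem contDiff_Ehat {n : WithTop ℕ∞} : ContDiff ℝ n D.Ehat := contDiff_trigSum _ _ _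

/-- `1/(F̂ + m²)` is smooth on `ℝ^d` (`K₂ ≥ 0`). [folklore] -/
theorem contDiff_inv_phi (hK₂ : 0 ≤ K₂) {n : WithTop ℕ∞} : ContDiff ℝ n fun k => (D.phi k)⁻¹ :=
  D.contDiff_phi.inv fun k => (D.phi_pos hK₂ k).ne'

/-- `1/(Â + λm²)` is smooth on `ℝ^d`. [folklore] -/
theorem contDiff_inv_areg (hd : 1 ≤ d) (hK₂ : 0 < K₂) (hρ : 0 < ρ) {n : WithTop ℕ∞} :
    ContDiff ℝ n fun k => (D.areg k)⁻¹ :=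
  D.contDiff_areg.inv fun k => (D.areg_pos hd hK₂ hρ k).ne'

/-- `f̂_m` is smooth on `ℝ^d`. [folklore] -/
theorem contDiff_fhat (hd : 1 ≤ d) (hK₂ : 0 < K₂) (hρ : 0 < ρ) {n : WithTop ℕ∞} : ContDiff ℝ n D.fhat := by
  unfold fhat
  exact D.contDiff_Ehat.div (D.contDiff_areg.mul D.contDiff_phi)
    fun k => mul_ne_zero (D.areg_pos hd hK₂ hρ k).ne' (D.phi_pos hK₂.le k).ne'

/-- **`∂_j^n f̂_m = ∂_j^n(1/(F̂ + m²)) - λ ∂_j^n(1/(Â + λm²))`.** [cite: LiuSlade2024, §2.1 and Proposition 2.4 (derivatives of f̂)] -/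
theorem dj_fhat (hd : 1 ≤ d) (hK₂ : 0 < K₂) (hρ : 0 < ρ) (j : Fin d) (n : ℕ) (k : Fin d → ℝ) :
    dj j n D.fhat k = dj j n (fun k' => (D.phi k')⁻¹) k - D.lam * dj j n (fun k' => (D.areg k')⁻¹) k := by
  have h : D.fhat = fun k' => (D.phi k')⁻¹ - D.lam * (D.areg k')⁻¹ := by
    funext k'; exact D.fhat_eq hd hK₂ hρ k'
  have h1 : ContDiff ℝ n fun s => (D.phi (Function.update k j s))⁻¹ :=
    (D.contDiff_phi_slice k j).inv fun s => (D.phi_pos hK₂.le _).ne'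
  have h2 : ContDiff ℝ n fun s => (D.areg (Function.update k j s))⁻¹ :=
    (D.contDiff_areg_slice k j).inv fun s => (D.areg_pos hd hK₂ hρ _).ne'
  rw [h, dj_sub h1 (contDiff_const.mul h2), dj_const_mul _ h2]

end Data

/-- `|∂_j^n Â| ≤ Σ_x ⟦x⟧^{-(d+1)}` for every `n` (a `d`-dependent constant).
[cite: LiuSlade2024, proof of Lemma 2.5 ("Â is infinitely classically differentiable … |Â_γ(k)| ≲ 1")] -/
theorem abs_dj_Ahat_le (hd : 1 ≤ d) (j : Fin d) (n : ℕ) (k : Fin d → ℝ) :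
    |dj j n (Ahat d) k| ≤ jsum d ((d : ℝ) + 1) := by
  unfold Ahat
  rw [dj_trigSum]
  have h := abs_trigSum_le_of_decay (nnSet d) (c := fun x => lsA d 1 x * ((x j : ℤ) : ℝ) ^ n) (K := 1)
    (b := (d : ℝ) + 1) zero_le_one (by linarith) (fun x _ => ?_) (0 + n * (π / 2)) k
  · rw [one_mul] at h; exact h
  · rw [one_mul, abs_mul, abs_pow]
    have h1 := abs_lsA_one_le hd ((d : ℝ) + 1 + n) x
    have h2 : |((x j : ℤ) : ℝ)| ^ n ≤ jnorm x ^ (n : ℝ) := by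
      rw [Real.rpow_natCast]
      exact pow_le_pow_left₀ (abs_nonneg _) ((abs_apply_le_euclidNorm x j).trans (euclidNorm_le_jnorm x)) n
    have hj0 := jnorm_pos x
    calc |lsA d 1 x| * |((x j : ℤ) : ℝ)| ^ n ≤ jnorm x ^ (-((d : ℝ) + 1 + n)) * jnorm x ^ (n : ℝ) :=
          mul_le_mul h1 h2 (by positivity) (Real.rpow_nonneg hj0.le _)
      _ = jnorm x ^ (-((d : ℝ) + 1)) := by rw [← Real.rpow_add hj0]; ring_nf

/-- **`|∂_j Â(k)| ≤ d (Σ_x ⟦x⟧^{-(d+1)}) ‖k‖_∞`.** [cite: LiuSlade2024, proof of Lemma 2.5 ("If |γ| = 1, by Taylor's theorem and symmetry, |Â_γ(k)| ≲ |k|")] -/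
theorem abs_dj_one_Ahat_le (hd : 1 ≤ d) (j : Fin d) (k : Fin d → ℝ) :
    |dj j 1 (Ahat d) k| ≤ d * jsum d ((d : ℝ) + 1) * ‖k‖ := by
  have h := abs_dj_one_trigSum_le (nnSet d) (c := lsA d 1) (K := 1) (b := (d : ℝ) + 1) zero_le_one
    (by linarith) (fun x _ => by rw [one_mul]; exact abs_lsA_one_le hd _ x) j k
  simpa [Ahat] using h


end LS24

end Literature.Barriers.CriticalPhenomena.SpreadOutIsing
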